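import Mathlib
import Summits.HodgeConjecture.HodgeConjecture.Theses.HeckePrymWeil

/-!
# Sketch — crux-ideate stmt-HodgeConjecture-1261 (WeilTwelvefoldsSqrtMinus7), ideator 3, round 1 (gen 1 + gen 2)

Part A (gen 1, card `klein-square-cm-branes`): the brane no-go at the CM-split anchor (`weilOp`,
`BraneNoGo`, `BraneNoGoRankOneException`).

Part B (gen 2, barrier note R5 "kernel rigidity" in IdeatorThreeNotes.md): the ARITHMETIC SKELETON of
the weight/bidegree bookkeeping behind the theorem "on a very general Weil-type abelian 2n-fold (n ≥ 2)
every n-dimensional subvariety Z has H^k(A,ℚ) ↪ H^k(Z̃,ℚ) for all k < n, and in degree n the kernel is 0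
or a Weil-extremal diagonal Γ_μ ⊂ ∧ⁿV_σ ⊕ ∧ⁿV_σ̄" — the representation theory (Schur, Pieri for SL_{2n},
hard Lefschetz) is in the notes; here only the linear-arithmetic case analysis is kernel-checked, in the
style of Disproof.lean §8 (documentary, all `omega`/`decide`).

Part C (gen 2, barrier note R7): the (7,3) Hecke–Prym locus meets toroidal cusps of depth 3, 1, 0
according as the vanishing monodromy m ∈ F₂₁ has order 1, 3, 7: double-coset counts |μ₃\F₂₁/⟨m⟩| =
7, 3, 1 (kernel-checked on an explicit model of F₂₁ = ℤ/7 ⋊ μ₃), torus ranks 6, 2, 0, abelian parts of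
dimension 6, 10, 12 (Riemann–Hurwitz re-derived).
-/

set_option linter.dupNamespace false

namespace Summit.HodgeConjecture.HodgeConjecture.Cruxes.WeilTwelvefoldsSqrtMinus7.KleinSquareCmBranes

open Matrix

/-! ## Part A (gen 1) -/

/-- Model of a Weil deformation direction `X ∈ 𝒲 ≅ Mₙ(ℂ)` acting on tangent data of the
CM-split anchor `E^n × Ē^n` (`T = V₊ ⊕ V₋`, `T̄ → T`, `b̄ ↦ X b` on one block and `ā ↦ Xᵀ a`
on the other — the transpose is the polarisation symmetry of Kodaira–Spencer classes):
`(a, b) ↦ (X *ᵥ star b, Xᵀ *ᵥ star a)`. An abelian subvariety with tangent space `S`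
deforms to first order along `X` iff `weilOp n X` maps `S` into `S` (card, lemma K0). -/
def weilOp (n : ℕ) (X : Matrix (Fin n) (Fin n) ℂ) (v : (Fin n → ℂ) × (Fin n → ℂ)) :
    (Fin n → ℂ) × (Fin n → ℂ) :=
  (X *ᵥ (star v.2), Xᵀ *ᵥ (star v.1))

/-- **BraneNoGo** (first lemma of the klein line; provable now, Mathlib only): for `n ≥ 2` the only
complex subspaces of `ℂⁿ × ℂⁿ` stable under every Weil-direction operator are `⊥` and `⊤`. -/
def BraneNoGo : Prop :=
  ∀ n : ℕ, 2 ≤ n → ∀ S : Submodule ℂ ((Fin n → ℂ) × (Fin n → ℂ)),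
    (∀ X : Matrix (Fin n) (Fin n) ℂ, ∀ v ∈ S, weilOp n X v ∈ S) → S = ⊥ ∨ S = ⊤

/-- The `n = 1` exception (persistence of the diagonal `Δ ⊂ E_t × E_t`, `|m| = 1`). -/
def BraneNoGoRankOneException : Prop :=
  ∀ m : ℂ, m * star m = 1 →
    ∀ X : Matrix (Fin 1) (Fin 1) ℂ, ∀ v ∈ Submodule.span ℂ ({((fun _ => 1), (fun _ => m))} :
      Set ((Fin 1 → ℂ) × (Fin 1 → ℂ))),
      weilOp 1 X v ∈ Submodule.span ℂ ({((fun _ => 1), (fun _ => m))} :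
        Set ((Fin 1 → ℂ) × (Fin 1 → ℂ)))

/-- The crux this seat serves, by name. -/
abbrev Crux : Prop :=
  Summit.HodgeConjecture.HodgeConjecture.Theses.HeckePrymWeil.WeilTwelvefoldsSqrtMinus7

example : Crux = Summit.HodgeConjecture.HodgeConjecture.Theses.HeckePrymWeil.WeilTwelvefoldsSqrtMinus7 := rfl

end Summit.HodgeConjecture.HodgeConjecture.Cruxes.WeilTwelvefoldsSqrtMinus7.KleinSquareCmBranes

/-! ## Part B (gen 2) — kernel rigidity: arithmetic skeleton

Setting (notes R5): `A` very general of Weil type `(n,n)`, Hodge group `SU(V,H)`, `V ⊗ ℂ = V_σ ⊕ V_σ̄`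
with `V_σ ≅ std`, `V_σ̄ ≅ std^∨ ≅ ∧^{2n-1} std` for `SL_{2n}`.  `H^k(A,ℂ) = ⊕_{p+q=k} ∧^p V_σ ⊗ ∧^q V_σ̄`
and, by Pieri, `∧^p std ⊗ ∧^q std^∨ ≅ ∧^p ⊗ ∧^{2n-q} = ⊕_{j=0}^{min(p,q)} V(ω_{p-j} + ω_{2n-q+j})`
(`ω_0 = ω_{2n} = 0`).  Write `a = p - j`, `b = 2n - q + j` for the two column lengths.  The lemmas
below are exactly the inequalities/equalities used to show: for `k < n` the constituents of distinct
bidegrees are pairwise distinct (so `H^k ⊗ ℂ` is multiplicity-free and every monodromy-invariant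
subspace is a sum of constituents), and at `k = n` the only coincidence is `(n,0) ~ (0,n)`
(`∧ⁿ std ≅ ∧ⁿ std^∨`, the volume-form diagonal).  The cohomological half — a constituent `C` in the
kernel of `H^k(A) → H^k(Z̃)` forces `(a θⁿ + m w) ∪ C = 0`, impossible by hard Lefschetz unless
`C = 0` or (`k = n`, `C = Γ_μ`, `a/m` extremal) — is prose in the notes. -/

namespace Summit.HodgeConjecture.HodgeConjecture.Cruxes.WeilTwelvefoldsSqrtMinus7.KernelRigidity

/-- Column lengths are separated below the middle degree: for `k < n`, `a = p - j ≤ n - 1 < n + 1 ≤ b`.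
[folklore] -/
theorem columns_separated (n k p q j : ℕ) (hk : k < n) (hpq : p + q = k) (hj : j ≤ p) (hj' : j ≤ q) :
    p - j ≤ n - 1 ∧ n + 1 ≤ 2 * n - q + j ∧ p - j < 2 * n - q + j := by
  omega

/-- Case (i) of the coincidence analysis: both short columns agree and both long columns agree
⇒ same bidegree. [folklore] -/
theorem coincidence_inner (n p q p' q' j j' : ℕ) (hpq : p + q = p' + q')
    (_hj : j ≤ q) (_hj' : j' ≤ q')
    (ha : p - j = p' - j') (hjp : j ≤ p) (hjp' : j' ≤ p')
    (hb : 2 * n - q + j = 2 * n - q' + j') (hq : q ≤ 2 * n) (hq' : q' ≤ 2 * n) : p = p' := by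
  omega

/-- Case (ii): both short columns are empty (`a = a' = 0`, i.e. `j = p`, `j' = p'`) and the long
columns agree ⇒ same bidegree. [folklore] -/
theorem coincidence_empty_short (n p q p' q' : ℕ) (hpq : p + q = p' + q') (_hp : p ≤ q) (_hp' : p' ≤ q')
    (hq : q ≤ 2 * n) (hq' : q' ≤ 2 * n)
    (hb : 2 * n - q + p = 2 * n - q' + p') : p = p' := by
  omega

/-- Case (iii): a long column is full (`b = 2n`, i.e. `j = q`) ⇒ `q ≤ p`; if moreover the short column
is empty then `p = q` (middle bidegree `(p,p)`), and two such with the same total degree coincide.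
[folklore] -/
theorem coincidence_full_long (p q p' q' : ℕ) (hpq : p + q = p' + q') (h : p = q) (h' : p' = q') :
    p = p' := by
  omega

/-- The one genuine coincidence sits in the middle degree: `(n,0)` (columns `n`, `2n`) and `(0,n)`
(columns `0`, `n`) give the same weight `ω_n` — `∧ⁿ std ≅ ∧ⁿ std^∨`; and in degree `k < n` the pure
bidegrees `(k,0)` / `(0,k)` give `ω_k ≠ ω_{2n-k}`. [folklore] -/
theorem pure_coincidence_iff_middle (n k : ℕ) (hn : 1 ≤ n) (hk : k ≤ n) :
    (k = 2 * n - k) ↔ k = n := by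
  omega

/-- **Why 2-form Lagrangian transport dies at `n ≥ 3` and lives at `n = 2`.**  `∧² std^∨ ≅ ∧^{2n-2} std`
is isomorphic to `∧² std` iff `2 = 2n - 2` iff `n = 2` (Klein quadric `𝔰𝔩₄ ≅ 𝔰𝔬₆`: Schoen's Lagrangian
surfaces in Weil fourfolds).  For `n ≥ 3` the four constituents `∧²`, `∧^{2n-2}`, `𝔰𝔩`, `𝟙` of
`H²(A,ℂ)` are pairwise distinct, every monodromy-invariant subspace of `H²(A,ℚ)` not containing `θ`
is `0`, `U'`, `U₈⁰` or `U' ⊕ U₈⁰`, and each non-zero option contradicts effectivity (notes R5–R6).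
[folklore] -/
theorem wedgeTwo_selfdual_iff (n : ℕ) (hn : 2 ≤ n) : (2 = 2 * n - 2) ↔ n = 2 := by
  omega

theorem wedgeTwo_not_selfdual_twelvefolds : (2 : ℕ) ≠ 2 * 6 - 2 := by decide

/-- Hard-Lefschetz window used twice: on an abelian `2n`-fold (`g = 2n`), `L^n : H^k → H^{k+2n}` is
injective as soon as `n ≤ g - k`, i.e. for every `k ≤ n`. [folklore] -/
theorem hardLefschetz_window (n k : ℕ) (hk : k ≤ n) : n ≤ 2 * n - k := by
  omega

/-- Bidegree bookkeeping of the effectivity contradiction at `n = 6`, `k = 2` (the 2-form case):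
`θ⁶ ∪ (2,0) ∈ (8,6)`, `θ⁶ ∪ (0,2) ∈ (6,8)`, `w₊ ∪ (0,2) ∈ (12,2)`, `w₋ ∪ (2,0) ∈ (2,12)` are four
distinct bidegrees of `H¹⁴`, so `(a θ⁶ + m w) ∪ U' = 0` forces `a = 0` and `m = 0` separately; and
`θ⁶ ∪ U₈⁰ ⊂ (7,7)` with `w ∪ U₈ = 0` forces `a = 0` alone. [folklore] -/
theorem bidegrees_twelvefolds_k2 :
    ((8, 6) : ℕ × ℕ) ≠ (6, 8) ∧ ((8, 6) : ℕ × ℕ) ≠ (12, 2) ∧ ((8, 6) : ℕ × ℕ) ≠ (2, 12) ∧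
    ((6, 8) : ℕ × ℕ) ≠ (12, 2) ∧ ((6, 8) : ℕ × ℕ) ≠ (2, 12) ∧ ((12, 2) : ℕ × ℕ) ≠ (2, 12) ∧
    8 + 6 = 14 ∧ 12 + 2 = 14 ∧ 7 + 7 = 14 := by
  decide

/-- Betti lower bounds forced on a transportable 6-cycle `Z` in a general Weil twelvefold:
`b_k(Z̃) ≥ b_k(A) = C(24,k)` for `k ≤ 5`, and `b₆(Z̃) ≥ C(24,6) - 924` (the degree-6 kernel is `0` or a
diagonal `Γ_μ` of dimension `C(12,6) = 924`); `h^{2,0}(A) = C(12,2) = 66`. [folklore] -/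
theorem betti_bounds_twelvefolds :
    Nat.choose 24 1 = 24 ∧ Nat.choose 24 2 = 276 ∧ Nat.choose 24 3 = 2024 ∧
    Nat.choose 24 4 = 10626 ∧ Nat.choose 24 5 = 42504 ∧ Nat.choose 24 6 = 134596 ∧
    Nat.choose 12 6 = 924 ∧ Nat.choose 12 2 = 66 := by
  decide

/-- Abelian-subvariety anchors fail the bound already in degree 1 and 2 (`E⁶ ⊂ E¹²`:
`b₁ = 12 < 24`, `b₂ = 66 < 276`), symmetric powers of the genus-15 Prym curve pass it
(`b₁(C^{(6)}) = 30 ≥ 24`, `b₂ = C(30,2)+1 = 436 ≥ 276`). [folklore] -/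
theorem anchor_filter_examples :
    2 * 6 < Nat.choose 24 1 ∧ Nat.choose 12 2 < Nat.choose 24 2 ∧
    24 ≤ 2 * 15 ∧ Nat.choose 24 2 ≤ Nat.choose 30 2 + 1 := by
  decide

end Summit.HodgeConjecture.HodgeConjecture.Cruxes.WeilTwelvefoldsSqrtMinus7.KernelRigidity

/-! ## Part C (gen 2) — where the (7,3) Hecke–Prym locus meets the toroidal boundary

`F₂₁ = ℤ/7 ⋊ μ₃` modelled on `Fin 3 × ZMod 7` as affine maps `x ↦ 2^i x + b`; `H = μ₃ = {(i,0)}`;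
the intermediate curve `C = C̃/H`.  When the genus-3 base acquires a node with vanishing monodromy
`m`, the admissible limit cover has `21/ord(m)` nodes upstairs and `|H \ F₂₁ / ⟨m⟩|` nodes on `C₀`;
the Prym acquires torus rank `|H\F₂₁/⟨m⟩| - 1`. -/

namespace Summit.HodgeConjecture.HodgeConjecture.Cruxes.WeilTwelvefoldsSqrtMinus7.PrymCusps

/-- Elements of `F₂₁`: `(i, b)` is the affine map `x ↦ 2^i · x + b` of `ZMod 7` (`2` has order `3`). -/
abbrev F21 : Type := Fin 3 × ZMod 7

/-- The multiplier `2^i ∈ (ZMod 7)ˣ`. -/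
def mul2 (i : Fin 3) : ZMod 7 := ![1, 2, 4] i

/-- Group law (composition of affine maps): `(i,b)·(i',b') = (i+i', 2^i b' + b)`. -/
def mulF (g h : F21) : F21 := (g.1 + h.1, mul2 g.1 * h.2 + g.2)

/-- `H = μ₃` (multipliers, no translation). -/
def inH (g : F21) : Bool := decide (g.2 = 0)

/-- Number of double cosets `H \ F₂₁ / M` by Burnside: `#orbits · |H| · |M| = Σ_{(h,m)} #{f : h f = f m}`. -/
def burnsideSum (M : List F21) : ℕ :=
  ((List.finRange 3).map fun i =>
    (M.map fun m => (Finset.univ.filter fun f : F21 => mulF ((i, 0) : F21) f = mulF f m).card).sum).sum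

/-- `M = 1`: `7` double cosets (`7 · 3 · 1 = 21`) — torus rank `6`, depth-3 cusp, abelian part the
étale (7,2) Hecke–Prym SIXFOLD. [folklore] -/
theorem dcosets_trivial : burnsideSum [((0 : Fin 3), (0 : ZMod 7))] = 7 * 3 * 1 := by decide

/-- `M = N = ℤ/7` (vanishing monodromy of order 7): `1` double coset (`1 · 3 · 7 = 21`) — torus rank `0`,
the limit Prym stays an abelian twelvefold (ramified Hecke–Prym over genus 2, two order-7 points).
[folklore] -/
theorem dcosets_order7 :
    burnsideSum ((List.finRange 7).map fun b : Fin 7 => ((0 : Fin 3), (b : ZMod 7))) = 1 * 3 * 7 := by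
  decide

/-- `M = ⟨(1,1)⟩`, a conjugate of `H` of order 3 (vanishing monodromy of order 3): `3` double cosets
(`3 · 3 · 3 = 27 = Σ fixed points`) — torus rank `2`, a DEPTH-ONE cusp of the hyperbolic ℚ(√-7)
component, abelian part a ramified Hecke–Prym TENFOLD. The subgroup: `(1,1)² = (2,3)`, `(1,1)³ = 1`.
[folklore] -/
theorem order3_subgroup :
    mulF ((1 : Fin 3), (1 : ZMod 7)) ((1 : Fin 3), (1 : ZMod 7)) = ((2 : Fin 3), (3 : ZMod 7)) ∧
    mulF ((2 : Fin 3), (3 : ZMod 7)) ((1 : Fin 3), (1 : ZMod 7)) = ((0 : Fin 3), (0 : ZMod 7)) := by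
  decide

theorem dcosets_order3 :
    burnsideSum [((0 : Fin 3), (0 : ZMod 7)), ((1 : Fin 3), (1 : ZMod 7)), ((2 : Fin 3), (3 : ZMod 7))]
      = 3 * 3 * 3 := by
  decide

/-- Torus ranks of the limit Prym `= #nodes(C₀) - 1` and the dimension split `12 = torus + abelian`.
[folklore] -/
theorem torus_ranks : 7 - 1 = 6 ∧ 3 - 1 = 2 ∧ 1 - 1 = 0 ∧ 6 + 6 = 12 ∧ 2 + 10 = 12 ∧ 0 + 12 = 12 := by
  decide

/-- Riemann–Hurwitz for the normalised degree-7 covers of the genus-2 normalisation of the nodal base: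
étale (`m = 1`): `2g-2 = 7·2`, `g = 8`, Prym dim `8 - 2 = 6`; order 3 (`m` acts on `F₂₁/H` with cycle
type `3+3+1` over each of the two preimages of the node): `2g-2 = 14 + 2·(2+2)`, `g = 12`, Prym dim `10`;
order 7 (cycle type `7`): `2g-2 = 14 + 2·6`, `g = 14`, Prym dim `12`. [folklore] -/
theorem normalisation_genera :
    (2 * 8 - 2 = 7 * (2 * 2 - 2)) ∧ (8 - 2 = 6) ∧
    (2 * 12 - 2 = 7 * (2 * 2 - 2) + 2 * ((3 - 1) + (3 - 1) + (1 - 1))) ∧ (12 - 2 = 10) ∧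
    (2 * 14 - 2 = 7 * (2 * 2 - 2) + 2 * (7 - 1)) ∧ (14 - 2 = 12) := by
  decide

end Summit.HodgeConjecture.HodgeConjecture.Cruxes.WeilTwelvefoldsSqrtMinus7.PrymCusps

/-! ## Part D (gen 2) — card `mu3-witt-tower-hecke-pryms`: the F₂₁ μ₃-Hurwitz–Prym tower

Levels of the tower: an F₂₁-cover of a genus-`g` curve with `r` branch points of order-3 local monodromy
has χ-multiplicity `2n` with `n = 3(g-1) + r = 3g + r - 3` (Chevalley–Weil: `3(2g-2) + 2r`, each order-3
point has codim-2 fixed space on χ), Hodge type `(n,n)` (each order-3 point contributes `2/3 + 1/3 = 1` to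
`h^{1,0}`), and `3g - 3 + r = n` moduli (for `g = 1`: `r`; for `g = 0`: `r - 3` — the same number).  A handle
degenerating with μ₃ vanishing monodromy sends `(g,r) ↦ (g-1, r+2)`, two order-3 points colliding with
order-3 product send `(0,r) ↦ (0,r-1)`; both drop the level by exactly one through a torus-rank-2
(depth-one) cusp (Part C, `dcosets_order3`).  The typed crux-facing statements: the rung predicate `HWA7`,
`Crux ↔ HWA7 6`, and the top of the tower handed to the route's `WeilDescending`. -/

namespace Summit.HodgeConjecture.HodgeConjecture.Cruxes.WeilTwelvefoldsSqrtMinus7.Mu3WittTower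

open Summit.HodgeConjecture.HodgeConjecture.Theses.HeckePrymWeil

/-- Level (= half-dimension `n` of the Prym) of the family with base genus `g` and `r` order-3 branch points. -/
def towerLevel (g r : ℕ) : ℕ := 3 * g + r - 3

/-- The six rungs of the μ₃-tower under the crux: (3,0) twelvefolds, (2,2) tenfolds, (1,4) eightfolds,
(0,6) sixfolds, (0,5) fourfolds = heptagonal genus-4 Jacobians, (0,4) Weil surfaces. [folklore] -/
theorem tower_levels :
    towerLevel 3 0 = 6 ∧ towerLevel 2 2 = 5 ∧ towerLevel 1 4 = 4 ∧
    towerLevel 0 6 = 3 ∧ towerLevel 0 5 = 2 ∧ towerLevel 0 4 = 1 := by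
  decide

/-- A handle degenerating with order-3 vanishing monodromy drops the level by exactly one. [folklore] -/
theorem handle_drops_one (g r : ℕ) (hg : 1 ≤ g) (h : 4 ≤ 3 * g + r) :
    towerLevel (g - 1) (r + 2) + 1 = towerLevel g r := by
  simp only [towerLevel]; omega

/-- Two order-3 branch points colliding with order-3 product drop the level by exactly one. [folklore] -/
theorem collision_drops_one (r : ℕ) (hr : 4 ≤ r) : towerLevel 0 (r - 1) + 1 = towerLevel 0 r := by
  simp only [towerLevel]; omega

/-- Moduli count of each family (`3g-3+r` for `g ≥ 2`, `r` for `g = 1`, `r-3` for `g = 0`). -/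
def moduli (g r : ℕ) : ℕ := if 2 ≤ g then 3 * g - 3 + r else if g = 1 then r else r - 3

/-- Moduli = level at every rung (so the anchor family has dimension `n` inside the `n²`-dimensional
hyperbolic component, codimension `n² - n`: 30, 20, 12, 6, 2, 0 — dominant exactly at the surface level).
[folklore] -/
theorem moduli_eq_level (g r : ℕ) (h : 2 ≤ g ∨ (g = 1) ∨ (g = 0 ∧ 3 ≤ r)) : moduli g r = towerLevel g r := by
  unfold moduli towerLevel
  rcases h with h | h | ⟨h, hr⟩
  · rw [if_pos h]; omega
  · subst h; simp
  · subst h; simp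

theorem codimensions :
    6 * 6 - 6 = 30 ∧ 5 * 5 - 5 = 20 ∧ 4 * 4 - 4 = 12 ∧ 3 * 3 - 3 = 6 ∧ 2 * 2 - 2 = 2 ∧ 1 * 1 - 1 = 0 := by
  decide

/-- Discriminants alternate down the depth-one cusps (`δ_{n+1} = -δ_n`, the hyperbolic plane has
discriminant `-1`), and "hyperbolic at level n" is `δ_n = (-1)^n`: consistent at every rung. [folklore] -/
theorem hyperbolic_signs (n : ℕ) : (-1 : ℤ) ^ (n + 1) = -((-1 : ℤ) ^ n) := by
  rw [pow_succ]; ring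

/-- Riemann–Hurwitz at the bottom rungs (degree-7 map to ℙ¹, each order-3 branch point of cycle type
`3+3+1` contributes `2+2 = 4`): (0,4): `g(C) = 2` (Weil surface `J(C)`), (0,5): `g(C) = 4` (the BASE of the
card: heptagonal genus-4 Jacobians, Weil fourfolds), (0,6): `g(C) = 6` (sixfolds); upstairs genus of the
F₂₁-Galois curve at (0,5): `2·15 - 2 + 42 = 5·14`. [folklore] -/
theorem bottom_genera :
    (2 * 2 - 2 + 14 = 4 * 4) ∧ (2 * 4 - 2 + 14 = 5 * 4) ∧ (2 * 6 - 2 + 14 = 6 * 4) ∧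
    (2 * 15 - 2 + 21 * 2 = 5 * (21 - 7)) := by
  decide

/-- Kernel-rigidity filter (Part B / notes R5) at the base level `n = 2`: a surface moving to the general
Weil fourfold needs `b₁(S̃) ≥ b₁(A) = 8`; symmetric squares of the genus-4 curve have `b₁ = 8` exactly.
[folklore] -/
theorem base_filter : Nat.choose 8 1 = 8 ∧ 2 * 4 = 8 := by decide

/-- The rung predicate of the ℚ(√-7) ladder in half-dimension `m` (the inner formula of the route's
`WeilDescending` at `p = 7`). -/
def HWA7 (m : ℕ) : Prop :=
  ∀ (A : Literature.AlgebraicGeometry.Motives.AbelianVariety ℂ) (φ : A ⟶ A), A.dim = (2 * m) →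
    CategoryTheory.CategoryStruct.comp φ φ = -((7 : ℤ) • CategoryTheory.CategoryStruct.id A) →
    ∀ c : Literature.AlgebraicGeometry.HodgeTheory.complexBetti A.X (2 * m),
      Literature.AlgebraicGeometry.HodgeTheory.IsRationalClass c →
      Literature.AlgebraicGeometry.HodgeTheory.IsOfHodgeType (2 * m) A.X (2 * m) m m c →
      c ∈ Module.End.eigenspace (Literature.AlgebraicGeometry.HodgeTheory.complexBetti.map
              (CategoryTheory.CategoryStruct.id A + φ).hom.hom.hom (2 * m)).hom
              ((1 + Complex.I * (Real.sqrt (7 : ℝ) : ℂ)) ^ (2 * m)) ⊔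
          Module.End.eigenspace (Literature.AlgebraicGeometry.HodgeTheory.complexBetti.map
              (CategoryTheory.CategoryStruct.id A + φ).hom.hom.hom (2 * m)).hom
              ((1 - Complex.I * (Real.sqrt (7 : ℝ) : ℂ)) ^ (2 * m)) →
      c ∈ Literature.AlgebraicGeometry.HodgeTheory.algebraicClasses A.X m

/-- The crux is literally rung 6. [folklore] -/
theorem crux_iff_rung_six : WeilTwelvefoldsSqrtMinus7 ↔ HWA7 6 := Iff.rfl

/-- **Top of the tower handed to descending**: the hyperbolic FOURTEENFOLD rung (level 7 of the cusp
induction; any single discriminant component in dimension 14 suffices mathematically — Koike's trick, here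
in the route's component-free form) gives the crux in every discriminant. [folklore] -/
theorem crux_of_rung_seven (hD : WeilDescending) (h7 : HWA7 7) : WeilTwelvefoldsSqrtMinus7 :=
  hD 7 (by norm_num) (by norm_num) le_rfl 6 (by norm_num) (fun m hm => by subst hm; exact h7)

/-- The induction shape of the card (pure logic): a base at level 2 and a level-raising step give every
level, in particular 6 (the hyperbolic half of the crux) and 7 (whence all of it by `crux_of_rung_seven`).
[folklore] -/
theorem tower_induction (P : ℕ → Prop) (base : P 2) (step : ∀ n, 2 ≤ n → P n → P (n + 1)) :
    ∀ n, 2 ≤ n → P n := by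
  intro n hn
  induction n with
  | zero => omega
  | succ k ih =>
    rcases Nat.lt_or_ge k 2 with hk | hk
    · interval_cases k <;> simp_all
    · exact step k hk (ih hk)

end Summit.HodgeConjecture.HodgeConjecture.Cruxes.WeilTwelvefoldsSqrtMinus7.Mu3WittTower
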